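import Literature.AlgebraicGeometry.Frobenioids.PadicKummerRemark242Arith
import Literature.AlgebraicGeometry.Frobenioids.PadicKummerSettingProofs
import HarnessLib

/-!
# Frobenioids II, Remark 2.4.2 vs Theorem 2.4 (i): the unit-wise Frobenius witness SATISFIES
# Theorem 2.4 (i) (Kummer and reciprocity compatibility) while violating (ii)'s conclusion

Proof-only companion (abc-iut cell, layer L1, seat abc-iut-w5-d248 gen 2; SUBDAG-FrdII-Thm24 row L26,
sequel to `PadicKummerRemark242Witness.lean` p418148 / `PadicKummerRemark242Arith.lean` p419520).

S. Mochizuki, *The geometry of Frobenioids II*, Kyushu J. Math. **62** (2008), Theorem 2.4 and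
Remark 2.4.2 pp. 19–22 [cite: MochizukiFrdII2008, Rmk 2.4.2 p.22]. The example `Ψ` of Remark 2.4.2
(the unit-wise Frobenius functor, `Φᵢ` absolutely primitive) is an equivalence of `p`-adic
Frobenioids, so Theorem 2.4 (i) APPLIES to it: the induced isomorphisms are "compatible with the
respective Kummer and reciprocity maps"; what fails is only (ii), whose hypothesis (fieldwise
saturation) is violated. This file makes that precise for the context-level witness: for an
isomorphism `e` of the Definition 2.2 data of `A` with itself which is the identity on `Aut_E(A_E)`
and the `n`-th power on `μ_N(A)`,

* `Def22Context.Iso.isoH1_eq_nsmul` — the induced `H¹(H_A, μ_N(A)) ⥲ H¹(H_A, μ_N(A))` is `n • id`;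
* `Def22Context.Iso.recTargetMap_eq_nsmul` — the induced map on `H_A^ab ⊗ F_N(A)` is `n • id`;
* `Def22Context.Iso.thm24i_of_muIso_eq_pow` — hence abc-iut-L1-t7's `Thm24i X X N p p fs fs
  (e.thm24Data N) ι ι` holds for EVERY duality isomorphism `ι` (both sides of the reciprocity
  square are multiplication by `n`), via abc-iut-L1-d4's `thm24i_of_inputs` (which PROVES the
  saturation transfer and the Kummer compatibility for any context isomorphism);
* `Def22Context.rmk242_witness_thm24i_and_incompatible` / `…_ofLocalField` — the witness data of
  Remark 2.4.2 satisfy Theorem 2.4 (i) (incl. the action clause `Thm24iActionCompat`) AND are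
  `InvariantIncompatible`, abstractly (bijective `n`-th power, `n ≢ 1 (mod N)`) and at the arithmetic
  context `ofLocalField L H hH O^×_L` (`N > 2`, unconditionally).

No new definitions; nothing here concerns [IUTchIII]; the predicates are abc-iut-L1-t7's.
-/

namespace Literature.AlgebraicGeometry.Frobenioids

namespace PadicKummer

open CategoryTheory groupCohomology Kummer
open scoped TensorProduct
open Literature.AnabelianGeometry.AbsoluteAnabelian (unitSubmonoid)

namespace Def22Context.Iso

variable {X : Def22Context} (e : Def22Context.Iso X X) (N : ℕ)

/-- For `e` the identity on `Aut_E(A_E)` and the `n`-th power on `μ_N(A)`, the induced isomorphism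
`H¹(H_A, μ_N(A)) ⥲ H¹(H_A, μ_N(A))` of Theorem 2.4 (i) is multiplication by `n` (the transported
cocycle is `k ↦ c(k)ⁿ`). [cite: MochizukiFrdII2008, Thm 2.4 (i) p.19] -/
theorem isoH1_eq_nsmul (n : ℕ) (hE : ∀ τ : X.AutE, e.isoE τ = τ)
    (hμ : ∀ ζ : Mu N X.O, e.muIso N ζ = ζ ^ n)
    (c : H1 (Rep.ofMulDistribMulAction X.HA (Mu N X.O))) : e.isoH1 N c = n • c := by
  induction c using H1_induction_on with
  | h x =>
    rw [isoH1_H1π]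
    have hc : mapCocycles₁ (e.isoHA.symm : X.HA →* X.HA) (e.muRepHom N) x = n • x := by
      refine cocycles₁_ext fun k => ?_
      rw [coe_mapCocycles₁]
      change Additive.ofMul (e.muIso N (Additive.toMul
          (show Additive (Mu N X.O) from x (e.isoHA.symm k)))) = (n • x) k
      rw [hμ, ofMul_pow, ofMul_toMul, e.isoHA_symm_eq_self_of_isoE hE]
      rfl
    rw [hc, map_nsmul]

/-- For such `e`, the induced map `H_A^ab ⊗ F_N(A) → H_A^ab ⊗ F_N(A)` on the codomain of the
reciprocity map is multiplication by `n` (identity on `H_A^ab`, `n` on `F_N(A)`).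
[cite: MochizukiFrdII2008, Thm 2.4 (i) p.19] -/
theorem recTargetMap_eq_nsmul (n : ℕ) (hE : ∀ τ : X.AutE, e.isoE τ = τ)
    (hμ : ∀ ζ : Mu N X.O, e.muIso N ζ = ζ ^ n) (t : RecTarget N X.O X.HA X.qHA) :
    (e.thm24Data N).recTargetMap t = n • t := by
  have h1 : (MonoidHom.toAdditive
      (Abelianization.map (e.thm24Data N).isoHA.toMonoidHom)).toIntLinearMap = LinearMap.id := by
    apply LinearMap.ext
    intro a
    have hid : (e.thm24Data N).isoHA.toMonoidHom = MonoidHom.id _ :=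
      MonoidHom.ext fun k => Subtype.ext (hE k)
    rw [hid, Abelianization.map_id]
    rfl
  have h2 : (e.thm24Data N).isoFN.toAddMonoidHom.toIntLinearMap = (n : ℤ) • LinearMap.id := by
    apply LinearMap.ext
    intro x
    rw [LinearMap.smul_apply, LinearMap.id_apply, natCast_zsmul]
    exact e.isoFN_eq_nsmul N n hE hμ x
  rw [Thm24Data.recTargetMap, h1, h2, TensorProduct.map_smul_right, TensorProduct.map_id,
    LinearMap.smul_apply, LinearMap.id_apply, natCast_zsmul]

/-- **Theorem 2.4 (i) HOLDS for the Remark 2.4.2 witness** (FrdII pp. 19–20): for `e` the identity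
on `Aut_E(A_E)` and the `n`-th power on `μ_N(A)`, the comparison data `e.thm24Data N` satisfy
`Thm24i` — `(N, H)`-saturation transfer, Kummer compatibility (both PROVED for every context
isomorphism by abc-iut-L1-d4) and reciprocity compatibility with the SAME duality isomorphism `ι` on
both sides (both routes are multiplication by `n`). [cite: MochizukiFrdII2008, Thm 2.4 (i) p.19] -/
theorem thm24i_of_muIso_eq_pow (n : ℕ) (hE : ∀ τ : X.AutE, e.isoE τ = τ)
    (hμ : ∀ ζ : Mu N X.O, e.muIso N ζ = ζ ^ n) (p : ℕ) (fs : Prop)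
    (ι : DualityIso N X.O X.HA X.qHA) : Thm24i X X N p p fs fs (e.thm24Data N) ι ι :=
  e.thm24i_of_inputs N p p fs fs ι ι rfl Iff.rfl fun c => by
    rw [e.recTargetMap_eq_nsmul N n hE hμ, e.isoH1_eq_nsmul N n hE hμ, map_nsmul]

end Def22Context.Iso

namespace Def22Context

/-- **Remark 2.4.2 against Theorem 2.4**, abstractly (FrdII pp. 19–22): for a context whose `n`-th
power map on `O^□(A)` is bijective and `n ≢ 1 (mod N)`, the `n`-th power automorphism of the
Definition 2.2 data yields ONE set of comparison data which satisfies Theorem 2.4 (i) (`Thm24i`, for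
every `p`, `fs` and duality isomorphism `ι`) together with its action clause (`Thm24iActionCompat`),
acts on `F_N(A)` by `n`, and is `InvariantIncompatible` for EVERY `inv` — so (ii)'s conclusion fails
although (i) holds. [cite: MochizukiFrdII2008, Rmk 2.4.2 p.22] -/
theorem rmk242_witness_thm24i_and_incompatible (X : Def22Context) (N n : ℕ)
    (hn : Function.Bijective fun x : X.O => x ^ n) (hζ : (n : ZMod N) ≠ 1) :
    ∃ e : Def22Context.Iso X X, (∀ x : X.O, e.isoO x = x ^ n) ∧ (∀ τ : X.AutE, e.isoE τ = τ) ∧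
      (∀ (p : ℕ) (fs : Prop) (ι : DualityIso N X.O X.HA X.qHA),
        Thm24i X X N p p fs fs (e.thm24Data N) ι ι) ∧
      Thm24iActionCompat X X N (e.thm24Data N) ∧
      (∀ inv : FNInvariant X N, ActsOnFNByPower X X N (e.thm24Data N) inv inv (n : ZMod N) ∧
        InvariantIncompatible X X N (e.thm24Data N) inv inv) := by
  obtain ⟨e, hO, hE, -, -⟩ := X.exists_iso_pow n hn
  have hμ := e.muIso_eq_pow_of_isoO_eq_pow N n hO
  exact ⟨e, hO, hE, fun p fs ι => e.thm24i_of_muIso_eq_pow N n hE hμ p fs ι, e.thm24iActionCompat N,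
    fun inv => ⟨e.actsOnFNByPower_of_muIso_eq_pow N n hE hμ inv,
      e.invariantIncompatible_of_muIso_eq_pow N n hE hμ hζ inv⟩⟩

variable {K : Type} [Field K] [ValuativeRel K] [TopologicalSpace K] [IsNonarchimedeanLocalField K]
  (L : IntermediateField K (AlgebraicClosure K)) [FiniteDimensional K L] [Normal K L]
  (H : Subgroup (Field.absoluteGaloisGroup K)) [H.Normal]
  (hH : IsOpen (H : Set (Field.absoluteGaloisGroup K)))

/-- **Remark 2.4.2 against Theorem 2.4 at the arithmetic context** `ofLocalField L H hH O^×_L`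
(`Φ` absolutely primitive), UNCONDITIONALLY: for `N > 2` there are comparison data (from an
automorphism of the Definition 2.2 data, identity on `Aut_E(A_E)`, an `ℓ`-th power on `O^×_L`)
satisfying Theorem 2.4 (i) for every `p`, `fs` and duality isomorphism `ι`, and its action clause, but
`InvariantIncompatible` for EVERY invariant isomorphism `inv` — so (ii)'s conclusion fails for them.
[cite: MochizukiFrdII2008, Rmk 2.4.2 p.22] -/
theorem rmk242_witness_thm24i_and_incompatible_ofLocalField (N : ℕ) (hN : 2 < N) :
    ∃ e : Def22Context.Iso (ofLocalField L H hH (unitsStableSubmonoid K L))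
        (ofLocalField L H hH (unitsStableSubmonoid K L)),
      (∀ τ, e.isoE τ = τ) ∧ (∀ (p : ℕ) (fs : Prop) ι, Thm24i _ _ N p p fs fs (e.thm24Data N) ι ι) ∧
        Thm24iActionCompat _ _ N (e.thm24Data N) ∧
        ∀ inv : FNInvariant (ofLocalField L H hH (unitsStableSubmonoid K L)) N,
          InvariantIncompatible _ _ N (e.thm24Data N) inv inv ∧
            ¬ Thm24ii _ _ N True True (e.thm24Data N) inv inv := by
  haveI : NeZero N := ⟨by omega⟩
  haveI : Fact (2 < N) := ⟨hN⟩
  obtain ⟨ℓ, -, hbij, hℓa⟩ :=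
    GalMonoid.exists_prime_pow_bijective_and_natCast_eq L N (a := -1) isUnit_one.neg
  have hne : ((ℓ : ℕ) : ZMod N) ≠ 1 := by
    rw [hℓa]
    exact ZMod.neg_one_ne_one
  obtain ⟨e, -, hE, hi, hact, hinc⟩ :=
    (ofLocalField L H hH (unitsStableSubmonoid K L)).rmk242_witness_thm24i_and_incompatible N ℓ
      hbij hne
  exact ⟨e, hE, hi, hact, fun inv => ⟨(hinc inv).2,
    fun hii => not_invariantIncompatible_of_thm24ii _ inv inv hii trivial trivial (hinc inv).2⟩⟩

end Def22Context

end PadicKummer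

end Literature.AlgebraicGeometry.Frobenioids
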